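import Summits.BirchSwinnertonDyer.Rank1Residual.Additive.CyclotomicTowerSignedLocal
import HarnessLib

/-!
# The `η`-odd Kummer line is TRANSVERSE to Kobayashi's minus condition: a bottom-layer point `P`
# with `τP = −P` lies in `E⁻(K_{n,v}) + q·E(K_{n,v})` only if `P ∈ q·E(K_{0,v})`
# (cell `b2b-bsdres`, CLASS-CLOSURE lane, class O10 — x1b GEN 31, class lead; the LOCAL heart of the
# (C3_η) recipe `u(p) = 0` of `class-closure/O10/C3ETA-ANATOMY-x1b.md` §3/§7, DERIVED from
# Kobayashi's Prop. 8.12 ii) taken as hypotheses on the tree's OWN objects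
# `towerSignedLocalPointsOfEmb` of `CyclotomicTowerSignedLocal.lean` (cc-typer-6 GEN 8))

HONEST FRAMING (cell `b2b-bsdres`, run/shared/lean/b2b/bsd-rank1-residual/, verbatim in every
file): the goal of the cell is to DELETE the COMBINATION-SHAPED residual classes of the
Birch–Swinnerton-Dyer formula for ALL analytic-rank `≤ 1` elliptic curves over `ℚ` — "full BSD
formula for every rank `≤ 1` curve in class `C`" assembled STRICTLY from published theorems — so
that the rank-`≤ 1` remainder becomes exactly the CONSTRUCTION-SHAPED classes, which are TYPED
(missing-input `Prop`s), NOT attempted. This is not "finishing BSD". CLASS-CLOSURE lane: prove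
what is provable now; shrink each hard class to its core with data; no claim beyond stated classes;
research routes on CONSTRUCTION-SHAPED X12 / O10; census / instrument output = EVIDENCE / conjecture
items, NEVER a Literature fact; `RESIDUAL-MAP.md` marks change only by signed lines. THIS FILE:
TOOL THEOREMS ONLY over cc-typer-6's vocabulary — no definition, no named Literature fact, no
Summits-side fact `def`, no `sorry`, axioms standard; Kobayashi's Prop. 8.12 ii) and Prop. 8.7 enter
as HYPOTHESES (`hsum`, `hint`, `htors`), never asserted; nothing is booked; no label / mark / count /
sub-cell moves; O10 stays OPEN / CONSTRUCTION-SHAPED; nothing about `BSD(W, p)` of any pair is claimed.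

## Source, verbatim (S. Kobayashi, Invent. Math. 152 (2003) [Kobayashi2003], held copy
`paper:doi-10-1007-s00222-002-0265-4`; page-read by x1b GEN 31, 2026-08-22)

§2 p. 4: "`E⁺(K_{n,v}) = {P ∈ E(K_{n,v}) | Tr_{n/m+1} P ∈ E(K_{m,v}) for even m (0 ≤ m < n)}`,
`E⁻(K_{n,v}) = {P ∈ E(K_{n,v}) | Tr_{n/m+1} P ∈ E(K_{m,v}) for odd m (−1 ≤ m < n)}`" (= the
tree's `towerSignedLocalPointsOfEmb U ι W (±1) n`, `K_{−1} = ℚ` the subgroup `⊤`).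
p. 16: "**Proposition 8.7.** The formal group `F_ss` has no `p`-power torsion point on the
cyclotomic field `k_n`." p. 17: "**Proposition 8.12.** … ii) For a non-negative integer `n`, we
have `C_ss(m_n) ∩ C_ss(m_{n−1}) = F_ss(m_{−1})` and `F_ss(m_n) = C_ss(m_n) + C_ss(m_{n−1})`."
p. 19 (Def. 8.16 and the display after it): "`Ê⁺(m_n) = C_Ê(m_n)` if `n` is even, `C_Ê(m_{n−1})`
if `n` is odd; `Ê⁻(m_n) = C_Ê(m_n)` if `n` is odd, `C_Ê(m_{n−1})` if `n` is even" — so Prop. 8.12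
ii) reads **`Ê⁺(m_n) ∩ Ê⁻(m_n) = Ê(m_{−1})` and `Ê(m_n) = Ê⁺(m_n) + Ê⁻(m_n)`**; p. 19:
"**Lemma 8.17.** The Kummer map induces an injection `Ê^±(m_n) ⊗ ℚ_p/ℤ_p → H¹(k_n, V/T)`. Proof. It
suffices to show that the natural map `Ê^±(m_n) ⊗ ℚ_p/ℤ_p → Ê(m_n) ⊗ ℚ_p/ℤ_p` is injective.
Suppose we have `P = p^k Q` where `P ∈ Ê^±(m_n)` and `Q ∈ Ê(m_n)`. Let `R = Tr_{n/m+1} Q`. Then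
if `(−1)^m = ±1`, we have `p^k(R^σ − R) = 0` for all `σ ∈ Gal(k_{m+1}/k_m)`. Hence by
Proposition 8.7, we have `R ∈ Ê(m_m)` and `Q ∈ Ê^±(m_n)`." (Remark, x1b GEN 31, for the
reading of the hypotheses on full points: `E(K_{n,v}) = Ê(m_n) ⊕ E(K_{n,v})[p+1]` since
`#Ẽ(𝔽_p) = p + 1` and `Ê(m_n)` is uniquely `(p+1)`-divisible, and `E(K_{n,v})[p+1] = E(ℚ_p)[p+1]`
because prime-to-`p` torsion is unramified and `K_{n,v}/ℚ_p` is totally ramified; as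
`E(ℚ_p) = E(K_{−1,v}) ≤ E^±(K_{n,v})` (`localFixedPointsOfEmb_top_le_towerSignedLocalPointsOfEmb`),
`E^±(K_{n,v}) = Ê^±(m_n) ⊕ E(ℚ_p)[p+1]` and both identities of Prop. 8.12 ii) hold verbatim for the
groups `E^±(K_{n,v})` of §2 p. 4 with `E(K_{−1,v})` in place of `Ê(m_{−1})` — this is how `hsum`,
`hint` below are meant to be discharged; they are NOT discharged here.)

## What is proved (generic: any field `K`, any antitone tower `U : ℕ → Subgroup Γ_K` of finite
## index, any model `E`, any embedding `ι`, any curve `W`, any odd `q : ℕ`)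

* §1 `smul_mem_localFixedPointsOfEmb`: `E(L_w)` is `Γ_E`-stable for `Gal(K̄/L)` normal;
  `towerSignedLocalPointsOfEmb_saturated` = **Lemma 8.17 PROVED** from the no-`q`-torsion hypothesis
  (Prop. 8.7): `q • Q ∈ E^ε(K_{n,v})`, `Q ∈ E(K_{n,v})` ⟹ `Q ∈ E^ε(K_{n,v})`.
* §2 THE BOTTOM LAYER: `E(K_{0,v}) ≤ E⁺(K_{n,v})` for every `n` (traces of a layer-`0` point are
  multiples of it); `P ∈ E(K_{0,v})` lies in `E⁻(K_{n,v})` iff `[k_n : k_0]·P ∈ E(K_{−1,v})` (only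
  the `m = −1` clause bites); hence an `η`-ODD bottom point (`τ • P = −P` for some `τ ∈ Γ_E`) in
  `E⁻(K_{n,v})` is `2[k_n:k_0]`-torsion — the `η ≠ 1` component of the minus condition is STRICT at
  the bottom layer (Kobayashi §2 p. 4, `m = −1`; the tree's `towerSignedLocalPointsOfEmb_neg_one_zero`
  is the case `n = 0`).
* §3 **TRANSVERSALITY** (`exists_mem_zero_eq_nsmul_of_eq_add_nsmul`): under Prop. 8.12 ii)
  (`hsum : E(K_{n,v}) ≤ E⁺ ⊔ E⁻`, `hint : E⁺ ⊓ E⁻ ≤ E(K_{−1,v})`) and Prop. 8.7 (`htors`), for `q`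
  odd: if an `η`-odd `P ∈ E(K_{0,v})` is `M + q • Q` with `M ∈ E⁻(K_{n,v})`, `Q ∈ E(K_{n,v})`, then
  `P = q • S` with `S ∈ E(K_{0,v})`. Proof: `Q = Q⁺ + Q⁻`; `P − qQ⁺ = M + qQ⁻ ∈ E⁺ ∩ E⁻ = E(K_{−1,v})`
  is `τ`-fixed, so `2P = q(Q⁺ − τQ⁺)`, `P = q·(P − k(Q⁺ − τQ⁺))` for `q = 2k+1`, and a `q`-th "root"
  of a `K_{0,v}`-point inside `E(K_{n,v})` is `K_{0,v}`-rational (no `q`-torsion). With §1 the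
  divisible form: `q^j • P = M + q^{j+1} • Q` already forces `P ∈ q·E(K_{0,v})`
  (`exists_mem_zero_eq_nsmul_of_pow_nsmul_eq_add`). READING (x1b GEN 31 memo
  `class-closure/O10/C3ETA-TRANSVERSALITY-x1b.md`): for `W = V ⊗ η`, `η = ω^{(p−1)/2}`, the generator
  of `W(ℚ_p) ⊗ ℤ_p = (V(k_0) ⊗ ℤ_p)^η` is `η`-odd and not in `p·V(k_0)`, so NO non-zero class of the
  Kummer line `W(ℚ_p) ⊗ ℚ_p/ℤ_p ⊂ H¹(ℚ_p, W[p^∞])` restricts into `E⁻(K_{n,v}) ⊗ ℚ_p/ℤ_p` at any layer: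
  the Kummer line meets the `η`-part of the minus condition TRIVIALLY — the local constant `u(p)` of
  the ANATOMY memo §3 is `0`, by Prop. 8.12 ii) alone (no Coleman map, no Perrin-Riou).

NOT here: Prop. 8.12 ii) itself (hypotheses), the corank of the `η`-minus condition (Thm. 6.2
(6.15)), any Selmer / control statement, any valuation identity; (C3_η) stays typed as filed
(`QuadraticBranchOddStrictExactControlOfPlusMCAt`, p307042) until the typer's pen moves.

References: [Kobayashi2003] §2 p. 4, Prop. 8.7 (p. 16), Prop. 8.12 (p. 17), Def. 8.16 + Lemma 8.17
(p. 19); [SerreGaloisCohomology1997] II.§1.1 (local subgroups at an embedding).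
-/

noncomputable section

open scoped Classical

universe u

namespace Summit.BirchSwinnertonDyer.Rank1Residual.Additive

open Literature.NumberTheory.EllipticCurves Literature.NumberTheory.GaloisRepresentations
  Literature.NumberTheory.EllipticCurves.Kobayashi2003 ZpExtension

/-! ## §1 Normal stability of `E(L_w)` and Lemma 8.17 (saturation of the signed groups) -/

section Stability

variable {K : Type u} [Field K] {E : Type u} [Field E] [Algebra K E]
  (ι : AlgebraicClosure K →ₐ[K] AlgebraicClosure E) (W : WeierstrassCurve K)

/-- For `H = Gal(K̄/L)` NORMAL in `Γ_K` the local subgroup `H_E` is normal in `Γ_E`, so `E(L_w)` is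
stable under all of `Γ_E`: `τ • (g • P) = g • ((g⁻¹τg) • P) = g • P`. Serre, *Galois Cohomology*,
II.§1.1. [cite: SerreGaloisCohomology1997, II.§1.1] -/
theorem smul_mem_localFixedPointsOfEmb (H : Subgroup (Field.absoluteGaloisGroup K)) [hH : H.Normal]
    (g : Field.absoluteGaloisGroup E) {P : localPoints W E}
    (hP : P ∈ localFixedPointsOfEmb ι W H) : g • P ∈ localFixedPointsOfEmb ι W H := by
  have hn : (localSubgroupOfEmb H ι).Normal := by
    unfold localSubgroupOfEmb
    exact hH.comap _
  rw [mem_localFixedPointsOfEmb_iff] at hP ⊢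
  intro τ hτ
  have hc : g⁻¹ * τ * g ∈ localSubgroupOfEmb H ι := hn.conj_mem' τ hτ g
  calc τ • g • P = (g * (g⁻¹ * τ * g)) • P := by
        rw [← mul_smul]; congr 1; group
    _ = g • P := by rw [mul_smul, hP _ hc]

variable (U : ℕ → Subgroup (Field.absoluteGaloisGroup K)) [hU : ∀ n, (U n).FiniteIndex]

/-- **A `q`-th "root" inside `E(L₂,w)` of an `E(L₁,w)`-point is `L₁,w`-rational when `E(L₂,w)` has no
`q`-torsion** (`L₂ ⊇ L₁`, `Gal(K̄/L₂)` normal): for `σ ∈ Gal(K̄/L₁)_E`, `q(σS − S) = σ(qS) − qS = 0`.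
The step "`p^k(R^σ − R) = 0` … hence by Proposition 8.7, `R ∈ Ê(m_m)`" of Lemma 8.17's proof.
[cite: Kobayashi2003, Lemma 8.17 (p. 19, proof), Prop. 8.7 (p. 16)] -/
theorem mem_localFixedPointsOfEmb_of_nsmul_mem {H₁ H₂ : Subgroup (Field.absoluteGaloisGroup K)}
    [H₂.Normal] {q : ℕ} (htors : ∀ Q ∈ localFixedPointsOfEmb ι W H₂, q • Q = 0 → Q = 0)
    {S : localPoints W E} (hS : S ∈ localFixedPointsOfEmb ι W H₂)
    (hqS : q • S ∈ localFixedPointsOfEmb ι W H₁) : S ∈ localFixedPointsOfEmb ι W H₁ := by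
  rw [mem_localFixedPointsOfEmb_iff]
  intro σ hσ
  have hdiff : σ • S - S ∈ localFixedPointsOfEmb ι W H₂ :=
    sub_mem (smul_mem_localFixedPointsOfEmb ι W H₂ σ hS) hS
  have hq : q • (σ • S - S) = 0 := by
    rw [smul_sub, ← smul_comm σ q S, (mem_localFixedPointsOfEmb_iff ι W H₁ _).mp hqS σ hσ, sub_self]
  exact sub_eq_zero.mp (htors _ hdiff hq)

/-- **Lemma 8.17 (PROVED, with Prop. 8.7 as the hypothesis `htors`): `E^ε(K_{n,v})` is
`q`-saturated in `E(K_{n,v})`.** If `Q ∈ E(K_{n,v})`, `q • Q ∈ E^ε(K_{n,v})`, and no non-zero point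
of `E(K_{n,v})` is killed by `q` (Prop. 8.7 for `q = p`), then `Q ∈ E^ε(K_{n,v})`: "Let
`R = Tr_{n/m+1} Q`. Then … `p^k(R^σ − R) = 0` for all `σ ∈ Gal(k_{m+1}/k_m)`. Hence by Proposition
8.7, we have `R ∈ Ê(m_m)` and `Q ∈ Ê^±(m_n)`" — for each signed `m < n`, and for the `m = −1` clause
with `E(K_{−1,v}) = E(E)`. Needs the tower antitone (so that `E(K_{m+1,v}) ≤ E(K_{n,v})` inherits
the no-torsion hypothesis) and the layers normal in `Γ_K`. Consequently
`E^ε(K_{n,v}) ⊗ ℚ_p/ℤ_p ↪ E(K_{n,v}) ⊗ ℚ_p/ℤ_p`. [cite: Kobayashi2003, Lemma 8.17 (p. 19), Prop. 8.7 (p. 16)] -/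
theorem towerSignedLocalPointsOfEmb_saturated (hUa : Antitone U) [hN : ∀ n, (U n).Normal]
    (ε : ℤˣ) (n : ℕ) {q : ℕ} (htors : ∀ Q ∈ localFixedPointsOfEmb ι W (U n), q • Q = 0 → Q = 0)
    {Q : localPoints W E} (hQ : Q ∈ localFixedPointsOfEmb ι W (U n))
    (hqQ : q • Q ∈ towerSignedLocalPointsOfEmb U ι W ε n) :
    Q ∈ towerSignedLocalPointsOfEmb U ι W ε n := by
  rw [mem_towerSignedLocalPointsOfEmb_iff] at hqQ ⊢
  have htors' : ∀ m ≤ n, ∀ R ∈ localFixedPointsOfEmb ι W (U m), q • R = 0 → R = 0 :=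
    fun m hm R hR h => htors R (localFixedPointsOfEmb_antitone ι W (hUa hm) hR) h
  refine ⟨hQ, fun m hm hε => ?_, fun hε => ?_⟩
  · -- `R = Tr_{n/m+1} Q ∈ E(K_{m+1,v})`, `q • R = Tr (q • Q) ∈ E(K_{m,v})`
    have hR : localPairTraceOfEmb ι W (U (m + 1)) (U n) Q ∈ localFixedPointsOfEmb ι W (U (m + 1)) :=
      localPairTraceOfEmb_mem_of_mem ι W hQ
    refine mem_localFixedPointsOfEmb_of_nsmul_mem ι W (htors' (m + 1) (by omega)) hR ?_
    rw [← map_nsmul]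
    exact hqQ.2.1 m hm hε
  · have hR : localPairTraceOfEmb ι W (U 0) (U n) Q ∈ localFixedPointsOfEmb ι W (U 0) :=
      localPairTraceOfEmb_mem_of_mem ι W hQ
    refine mem_localFixedPointsOfEmb_of_nsmul_mem ι W (htors' 0 (Nat.zero_le n)) hR ?_
    rw [← map_nsmul]
    exact hqQ.2.2 hε

end Stability

/-! ## §2 The bottom layer `K_{0,v}` inside the signed groups -/

section Bottom

variable {K : Type u} [Field K] {E : Type u} [Field E] [Algebra K E]
  (U : ℕ → Subgroup (Field.absoluteGaloisGroup K)) [hU : ∀ n, (U n).FiniteIndex]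
  (ι : AlgebraicClosure K →ₐ[K] AlgebraicClosure E) (W : WeierstrassCurve K)

/-- **`E(K_{0,v}) ≤ E⁺(K_{n,v})` for every `n`** (antitone tower): for `P ∈ E(K_{0,v})` and
`m ≥ 0`, `Tr_{n/m+1} P = [K_{n,v} : K_{m+1,v}]·P ∈ E(K_{0,v}) ≤ E(K_{m,v})`
(`localPairTraceOfEmb_apply_of_mem_lower`); the plus side has no `m = −1` clause. So the bottom
Kummer line lies INSIDE the plus condition at every layer. [cite: Kobayashi2003, §2 p. 4 (E⁺: even m, 0 ≤ m < n)] -/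
theorem localFixedPointsOfEmb_zero_le_towerSignedLocalPointsOfEmb_one (hUa : Antitone U) (n : ℕ) :
    localFixedPointsOfEmb ι W (U 0) ≤ towerSignedLocalPointsOfEmb U ι W 1 n := by
  intro P hP
  rw [mem_towerSignedLocalPointsOfEmb_one_iff]
  refine ⟨localFixedPointsOfEmb_antitone ι W (hUa (Nat.zero_le n)) hP, fun m _ _ => ?_⟩
  rw [localPairTraceOfEmb_apply_of_mem_lower ι W
    (localFixedPointsOfEmb_antitone ι W (hUa (Nat.zero_le (m + 1))) hP)]
  exact localFixedPointsOfEmb_antitone ι W (hUa (Nat.zero_le m)) (AddSubgroup.nsmul_mem _ hP _)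

/-- **For a bottom-layer point only the `m = −1` clause bites**: `P ∈ E(K_{0,v})` lies in
`E⁻(K_{n,v})` iff `Tr_{n/0} P = [K_{n,v} : K_{0,v}]·P ∈ E(K_{−1,v})` (the odd `m ≥ 1` conditions hold
as on the plus side). [cite: Kobayashi2003, §2 p. 4 (E⁻: odd m, −1 ≤ m < n)] -/
theorem mem_towerSignedLocalPointsOfEmb_neg_one_iff_of_mem_zero (hUa : Antitone U) (n : ℕ)
    {P : localPoints W E} (hP : P ∈ localFixedPointsOfEmb ι W (U 0)) :
    P ∈ towerSignedLocalPointsOfEmb U ι W (-1) n ↔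
      ((localSubgroupOfEmb (U n) ι).subgroupOf (localSubgroupOfEmb (U 0) ι)).index • P ∈
        localFixedPointsOfEmb ι W ⊤ := by
  rw [mem_towerSignedLocalPointsOfEmb_neg_one_iff, localPairTraceOfEmb_apply_of_mem_lower ι W hP]
  refine ⟨fun h => h.2.2, fun h => ⟨localFixedPointsOfEmb_antitone ι W (hUa (Nat.zero_le n)) hP,
    fun m _ _ => ?_, h⟩⟩
  rw [localPairTraceOfEmb_apply_of_mem_lower ι W
    (localFixedPointsOfEmb_antitone ι W (hUa (Nat.zero_le (m + 1))) hP)]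
  exact localFixedPointsOfEmb_antitone ι W (hUa (Nat.zero_le m)) (AddSubgroup.nsmul_mem _ hP _)

/-- **The `η`-odd part of the minus condition is STRICT at the bottom layer**: if `P ∈ E(K_{0,v})`
is `η`-odd (`τ • P = −P` for some `τ ∈ Γ_E` — e.g. `P` in the image of `W(ℚ_p) = V(ℚ_p(√p*))⁻` for
the twist `W = V ⊗ η`) and `P ∈ E⁻(K_{n,v})`, then `2[K_{n,v} : K_{0,v}]·P = 0`: `N·P ∈ E(K_{−1,v})`
is `τ`-fixed and `τ(N·P) = −N·P`. (Kobayashi: "`E⁻(k_0) = E(k_{−1})`", whose `η ≠ 1` part is `0`;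
this is the every-layer form.) [cite: Kobayashi2003, §2 p. 4 (m = −1, K_{−1} = ℚ)] -/
theorem two_mul_index_nsmul_eq_zero_of_mem_neg_one (hUa : Antitone U) (n : ℕ)
    {P : localPoints W E} (hP : P ∈ localFixedPointsOfEmb ι W (U 0))
    {τ : Field.absoluteGaloisGroup E} (hτ : τ • P = -P)
    (hmem : P ∈ towerSignedLocalPointsOfEmb U ι W (-1) n) :
    (2 * ((localSubgroupOfEmb (U n) ι).subgroupOf (localSubgroupOfEmb (U 0) ι)).index) • P = 0 := by
  set N := ((localSubgroupOfEmb (U n) ι).subgroupOf (localSubgroupOfEmb (U 0) ι)).index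
  have hN : N • P ∈ localFixedPointsOfEmb ι W ⊤ :=
    (mem_towerSignedLocalPointsOfEmb_neg_one_iff_of_mem_zero U ι W hUa n hP).mp hmem
  have hfix : τ • (N • P) = N • P := (mem_localFixedPointsOfEmb_top_iff ι W _).mp hN τ
  rw [smul_comm, hτ, smul_neg] at hfix
  rw [mul_nsmul', two_nsmul]
  -- hfix : -(N • P) = N • P
  calc N • P + N • P = N • P + -(N • P) := by rw [hfix]
    _ = 0 := add_neg_cancel _

end Bottom

/-! ## §3 Transversality modulo Prop. 8.12 ii) -/

section Transverse

variable {K : Type u} [Field K] {E : Type u} [Field E] [Algebra K E]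
  (U : ℕ → Subgroup (Field.absoluteGaloisGroup K)) [hU : ∀ n, (U n).FiniteIndex]
  (ι : AlgebraicClosure K →ₐ[K] AlgebraicClosure E) (W : WeierstrassCurve K)

/-- **TRANSVERSALITY of the `η`-odd bottom line to the minus condition (modulo Prop. 8.12 ii)).**
Tower `U` antitone with `U n` normal; HYPOTHESES: `hsum : E(K_{n,v}) ≤ E⁺(K_{n,v}) ⊔ E⁻(K_{n,v})` and
`hint : E⁺(K_{n,v}) ⊓ E⁻(K_{n,v}) ≤ E(K_{−1,v})` (Prop. 8.12 ii) with Def. 8.16), `htors`: no point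
of `E(K_{n,v})` is `q`-torsion (Prop. 8.7, `q = p`), `q` odd. If `P ∈ E(K_{0,v})` is `η`-odd
(`τ • P = −P`) and `P = M + q • Q` with `M ∈ E⁻(K_{n,v})`, `Q ∈ E(K_{n,v})`, then `P = q • S` for some
`S ∈ E(K_{0,v})`. Proof: `Q = Q⁺ + Q⁻`; `Z := P − qQ⁺ = M + qQ⁻ ∈ E⁺ ∩ E⁻ = E(K_{−1,v})` (`P ∈ E⁺`
by §2) is `τ`-fixed, whence `2P = q(Q⁺ − τQ⁺)`; for `q = 2k+1`, `P = qP − k·2P = q·(P − k(Q⁺ − τQ⁺))`,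
and the `q`-th root `S = P − k(Q⁺ − τQ⁺) ∈ E(K_{n,v})` of the `K_{0,v}`-point `P` is `K_{0,v}`-rational
(§1). [cite: Kobayashi2003, Prop. 8.12 ii) (p. 17), Def. 8.16 (p. 19), Prop. 8.7 (p. 16)] -/
theorem exists_mem_zero_eq_nsmul_of_eq_add_nsmul (hUa : Antitone U) (n : ℕ) [hn : (U n).Normal]
    (hsum : localFixedPointsOfEmb ι W (U n) ≤
      towerSignedLocalPointsOfEmb U ι W 1 n ⊔ towerSignedLocalPointsOfEmb U ι W (-1) n)
    (hint : towerSignedLocalPointsOfEmb U ι W 1 n ⊓ towerSignedLocalPointsOfEmb U ι W (-1) n ≤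
      localFixedPointsOfEmb ι W ⊤)
    {q : ℕ} (hq : Odd q) (htors : ∀ Q ∈ localFixedPointsOfEmb ι W (U n), q • Q = 0 → Q = 0)
    {P : localPoints W E} (hP : P ∈ localFixedPointsOfEmb ι W (U 0))
    {τ : Field.absoluteGaloisGroup E} (hτ : τ • P = -P)
    {M Q : localPoints W E} (hM : M ∈ towerSignedLocalPointsOfEmb U ι W (-1) n)
    (hQ : Q ∈ localFixedPointsOfEmb ι W (U n)) (hPMQ : P = M + q • Q) :
    ∃ S ∈ localFixedPointsOfEmb ι W (U 0), P = q • S := by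
  have hPn : P ∈ localFixedPointsOfEmb ι W (U n) := localFixedPointsOfEmb_antitone ι W (hUa n.zero_le) hP
  -- split `Q = Q⁺ + Q⁻` (Prop. 8.12 ii), second identity)
  obtain ⟨Qp, hQp, Qm, hQm, hQsum⟩ := AddSubgroup.mem_sup.mp (hsum hQ)
  have hQpn : Qp ∈ localFixedPointsOfEmb ι W (U n) := towerSignedLocalPointsOfEmb_le U ι W 1 n hQp
  -- `Z = P - q • Q⁺ = M + q • Q⁻ ∈ E⁺ ⊓ E⁻ ≤ E(K_{-1,v})` (Prop. 8.12 ii), first identity)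
  have hZ : P - q • Qp ∈ localFixedPointsOfEmb ι W ⊤ := by
    have h1 : P - q • Qp ∈ towerSignedLocalPointsOfEmb U ι W 1 n :=
      (towerSignedLocalPointsOfEmb U ι W 1 n).sub_mem
        (localFixedPointsOfEmb_zero_le_towerSignedLocalPointsOfEmb_one U ι W hUa n hP)
        ((towerSignedLocalPointsOfEmb U ι W 1 n).nsmul_mem hQp q)
    have h2 : P - q • Qp ∈ towerSignedLocalPointsOfEmb U ι W (-1) n := by
      have e : P - q • Qp = M + q • Qm := by rw [hPMQ, ← hQsum, smul_add]; abel
      rw [e]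
      exact (towerSignedLocalPointsOfEmb U ι W (-1) n).add_mem hM
        ((towerSignedLocalPointsOfEmb U ι W (-1) n).nsmul_mem hQm q)
    exact hint (AddSubgroup.mem_inf.mpr ⟨h1, h2⟩)
  -- `τ` fixes `Z`, hence `2P = q(Q⁺ - τQ⁺)`
  have hτZ : τ • (P - q • Qp) = P - q • Qp := (mem_localFixedPointsOfEmb_top_iff ι W _).mp hZ τ
  rw [smul_sub, hτ, smul_comm] at hτZ
  -- hτZ : -P - q • τ • Qp = P - q • Qp
  have h2 : (2 : ℕ) • P = q • (Qp - τ • Qp) := by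
    rw [smul_sub, two_nsmul]
    calc P + P = P + P + ((-P - q • τ • Qp) - (P - q • Qp)) := by rw [hτZ, sub_self, add_zero]
      _ = q • Qp - q • τ • Qp := by abel
  -- `q = 2k + 1`: `P = q • (P - k • (Q⁺ - τQ⁺))`
  obtain ⟨k, hk⟩ := hq
  set R := Qp - τ • Qp with hR
  have hRn : R ∈ localFixedPointsOfEmb ι W (U n) :=
    sub_mem hQpn (smul_mem_localFixedPointsOfEmb ι W (U n) τ hQpn)
  have hSn : P - k • R ∈ localFixedPointsOfEmb ι W (U n) := sub_mem hPn (AddSubgroup.nsmul_mem _ hRn k)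
  have hqS : q • (P - k • R) = P := by
    rw [smul_sub, smul_comm q k R, ← h2, ← mul_nsmul', hk]
    rw [add_nsmul, one_nsmul, mul_comm k 2, add_sub_cancel_left]
  refine ⟨P - k • R, ?_, hqS.symm⟩
  exact mem_localFixedPointsOfEmb_of_nsmul_mem ι W htors hSn (by rw [hqS]; exact hP)

/-- Contrapositive: an `η`-odd bottom point NOT `q`-divisible in `E(K_{0,v})` is NOT in
`E⁻(K_{n,v}) + q·E(K_{n,v})`, at any layer `n`. [cite: Kobayashi2003, Prop. 8.12 ii) (p. 17), Prop. 8.7 (p. 16)] -/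
theorem not_exists_eq_add_nsmul_of_not_nsmul (hUa : Antitone U) (n : ℕ) [(U n).Normal]
    (hsum : localFixedPointsOfEmb ι W (U n) ≤
      towerSignedLocalPointsOfEmb U ι W 1 n ⊔ towerSignedLocalPointsOfEmb U ι W (-1) n)
    (hint : towerSignedLocalPointsOfEmb U ι W 1 n ⊓ towerSignedLocalPointsOfEmb U ι W (-1) n ≤
      localFixedPointsOfEmb ι W ⊤)
    {q : ℕ} (hq : Odd q) (htors : ∀ Q ∈ localFixedPointsOfEmb ι W (U n), q • Q = 0 → Q = 0)
    {P : localPoints W E} (hP : P ∈ localFixedPointsOfEmb ι W (U 0))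
    {τ : Field.absoluteGaloisGroup E} (hτ : τ • P = -P)
    (hndiv : ∀ S ∈ localFixedPointsOfEmb ι W (U 0), P ≠ q • S) :
    ¬ ∃ M ∈ towerSignedLocalPointsOfEmb U ι W (-1) n, ∃ Q ∈ localFixedPointsOfEmb ι W (U n),
      P = M + q • Q := by
  rintro ⟨M, hM, Q, hQ, hPMQ⟩
  obtain ⟨S, hS, hPS⟩ :=
    exists_mem_zero_eq_nsmul_of_eq_add_nsmul U ι W hUa n hsum hint hq htors hP hτ hM hQ hPMQ
  exact hndiv S hS hPS

/-- **Divisible (Kummer-level) form.** Same hypotheses; if `q^j • P = M + q^(j+1) • Q` with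
`M ∈ E⁻(K_{n,v})`, `Q ∈ E(K_{n,v})` — i.e. the class `P ⊗ q^{−1}` of `E(K_{n,v}) ⊗ ℚ_q/ℤ_q` written
with denominator `q^{j+1}` lies in the image of `E⁻(K_{n,v}) ⊗ ℚ_q/ℤ_q` — then `P ∈ q·E(K_{0,v})`:
`M = q^j • (P − q • Q)` so `P − q • Q ∈ E⁻(K_{n,v})` by Lemma 8.17 (§1, `j` times), and §3 applies to
`P = (P − qQ) + qQ`. Hence for `P` not `q`-divisible in `E(K_{0,v})` (the `η`-odd generator), NO
non-zero element of the bottom Kummer line `⟨P⟩ ⊗ ℚ_q/ℤ_q` lands in `E⁻(K_{n,v}) ⊗ ℚ_q/ℤ_q`, at any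
layer. [cite: Kobayashi2003, Prop. 8.12 ii) (p. 17), Lemma 8.17 (p. 19), Prop. 8.7 (p. 16)] -/
theorem exists_mem_zero_eq_nsmul_of_pow_nsmul_eq_add (hUa : Antitone U) [hN : ∀ n, (U n).Normal]
    (n : ℕ)
    (hsum : localFixedPointsOfEmb ι W (U n) ≤
      towerSignedLocalPointsOfEmb U ι W 1 n ⊔ towerSignedLocalPointsOfEmb U ι W (-1) n)
    (hint : towerSignedLocalPointsOfEmb U ι W 1 n ⊓ towerSignedLocalPointsOfEmb U ι W (-1) n ≤
      localFixedPointsOfEmb ι W ⊤)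
    {q : ℕ} (hq : Odd q) (htors : ∀ Q ∈ localFixedPointsOfEmb ι W (U n), q • Q = 0 → Q = 0)
    {P : localPoints W E} (hP : P ∈ localFixedPointsOfEmb ι W (U 0))
    {τ : Field.absoluteGaloisGroup E} (hτ : τ • P = -P) (j : ℕ)
    {M Q : localPoints W E} (hM : M ∈ towerSignedLocalPointsOfEmb U ι W (-1) n)
    (hQ : Q ∈ localFixedPointsOfEmb ι W (U n)) (hPMQ : q ^ j • P = M + q ^ (j + 1) • Q) :
    ∃ S ∈ localFixedPointsOfEmb ι W (U 0), P = q • S := by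
  have hPn : P ∈ localFixedPointsOfEmb ι W (U n) := localFixedPointsOfEmb_antitone ι W (hUa n.zero_le) hP
  have hD : P - q • Q ∈ localFixedPointsOfEmb ι W (U n) := sub_mem hPn (AddSubgroup.nsmul_mem _ hQ q)
  -- `M = q^j • (P - q • Q)`
  have hMeq : q ^ j • (P - q • Q) = M := by
    rw [smul_sub, hPMQ, pow_succ, mul_nsmul', add_sub_cancel_right]
  -- saturation, `j` times
  have hsat : ∀ i : ℕ, ∀ D ∈ localFixedPointsOfEmb ι W (U n),
      q ^ i • D ∈ towerSignedLocalPointsOfEmb U ι W (-1) n →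
        D ∈ towerSignedLocalPointsOfEmb U ι W (-1) n := by
    intro i
    induction i with
    | zero => intro D _ h; simpa using h
    | succ i ih =>
      intro D hDn h
      rw [pow_succ, mul_nsmul] at h
      exact ih D hDn (towerSignedLocalPointsOfEmb_saturated ι W U hUa (-1) n htors
        (AddSubgroup.nsmul_mem _ hDn _) h)
  have hDm : P - q • Q ∈ towerSignedLocalPointsOfEmb U ι W (-1) n := hsat j _ hD (hMeq ▸ hM)
  exact exists_mem_zero_eq_nsmul_of_eq_add_nsmul U ι W hUa n hsum hint hq htors hP hτ hDm hQ
    (by rw [sub_add_cancel])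

end Transverse

end Summit.BirchSwinnertonDyer.Rank1Residual.Additive

end
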